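import Mathlib.LinearAlgebra.FiniteDimensional.Lemmas
import Literature.Barriers.Schanuel.AlgebraicIndependenceOfLogarithmsThm4Proofs
import Literature.Barriers.Schanuel.LinearSubgroupMethodLimitLemmas
import HarnessLib

/-!
# Barrier (Schanuel): rational structures on `K^n` — lemmas for Roy 1992, Theorem 2 ⇒ Theorem 4

Support file (linear algebra only, everything proved) for the deduction of Roy's Theorem 4 from
his Theorem 2 ([Roy1992], §4 pp. 34–37), continuing the companions
`Literature.Barriers.Schanuel.AlgebraicIndependenceOfLogarithmsThm4Proofs` (Theorem 4 as the named
fact `roy1992_thm4`, Corollary 1 and the strong six exponentials theorem proved from it) and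
`Literature.Barriers.Schanuel.AlgebraicIndependenceOfLogarithmsRoyThm12` (Theorems 1–2 as named
facts). Roy's proof manipulates, for fields `F ⊂ K` (`F = ℚ`, `ℚ̄` or a number field `k`,
`K = ℂ`), the `F`-structure `F^n ⊂ K^n` [Roy1992, Notations p. 24, after Bourbaki, Alg. II §8]:
subspaces of `K^n` rational over `F` (generated by vectors of `F^n`), `K`-linear maps rational
over `F`, and the facts that dimensions and ranks do not change under the base change `F → K`.
This file provides that dictionary in the generality of a field extension `K/F`
(`[Algebra F K]`), in the sub-namespace `Roy1992`:

* `Roy1992.incl F K n` — the coordinatewise inclusion `F^n → K^n`; `Roy1992.spanK T` — the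
  `K`-span of an `F`-subspace `T ⊆ F^n` (the subspace of `K^n` rational over `F` with `F`-points `T`).
* `Roy1992.finrank_spanK` — `dim_K spanK T = dim_F T`; `Roy1992.mem_of_incl_mem_spanK` — `spanK T`
  has no new `F`-points; `Roy1992.rank_map_algebraMap` — the rank of a matrix is invariant under
  base change; `Roy1992.ker_mulVecLin_map` — the kernel of a matrix over `F`, viewed over `K`, is
  the `K`-span of its kernel over `F` (kernels of rational maps are rational).
* `Roy1992.exists_surjective_ker_eq_spanK` — every subspace rational over `F` is the kernel of a
  surjective `K`-linear map given by a matrix over `F` ("a surjective `K`-linear mapping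
  `t₁ : K^d → K^{d₁}` which is rational over `ℚ̄`, with kernel `T`", p. 35).
* `Roy1992.fPoints T` — the `F`-points of a `K`-subspace (`spanK (fPoints T) ≤ T`,
  `fPoints (spanK T) = T`).
* dimension bookkeeping: `Roy1992.comap_sup_eq_comap`, `Roy1992.finrank_map_add_finrank_ker`,
  `Roy1992.finrank_comap_of_surjective`, `Roy1992.finrank_prod_eq`.

The `ℂ`-specific steps (admissible maps of Theorems 1–2 are products `s₀ × s₁` of a `ℚ̄`-rational
and a `ℚ`-rational map; the number field and the map `φ` of p. 35) are in the next companion.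

## References

* [Roy1992] D. Roy, *Matrices whose coefficients are linear forms in logarithms*, J. Number
  Theory 41 (1992) 22–47: Notations p. 24; §4, proof of Theorem 4, pp. 34–36.
-/

noncomputable section

open Module Submodule

namespace Literature.Barriers.Schanuel.Roy1992

variable (F K : Type*) [Field F] [Field K] [Algebra F K]

/-! ### The `F`-structure `F^n ⊂ K^n` -/

/-- The coordinatewise inclusion `F^n → K^n` (an `F`-linear map). [cite: Roy1992, Notations (p. 24)] -/
def incl (n : ℕ) : (Fin n → F) →ₗ[F] (Fin n → K) :=
  (Algebra.linearMap F K).compLeft (Fin n)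

variable {F K}

/-- `incl` is `algebraMap` in each coordinate. [folklore] -/
@[simp] theorem incl_apply {n : ℕ} (c : Fin n → F) (i : Fin n) :
    incl F K n c i = algebraMap F K (c i) := rfl

/-- `incl` is injective. [folklore] -/
theorem incl_injective (n : ℕ) : Function.Injective (incl F K n) := by
  intro x y hxy
  funext i
  have := congrFun hxy i
  simpa using this

variable (K) in
/-- The `K`-subspace of `K^n` **rational over `F`** with `F`-points `T`: the `K`-span of the image of
the `F`-subspace `T ⊆ F^n`. [cite: Roy1992, Notations (p. 24)] -/
def spanK {n : ℕ} (T : Submodule F (Fin n → F)) : Submodule K (Fin n → K) :=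
  span K (incl F K n '' T)

/-- **Base change of linear independence** (repackaging of
`Roy1995.linearIndependent_algebraMap_pi`): an `F`-independent family of `F^n` is `K`-independent
in `K^n`. [folklore] -/
theorem linearIndependent_incl_comp {n r : ℕ} {v : Fin r → Fin n → F} (hv : LinearIndependent F v) :
    LinearIndependent K (incl F K n ∘ v) :=
  Roy1995.linearIndependent_algebraMap_pi hv


/-- A submodule is the span of (the images of) the vectors of any of its bases. [folklore] -/
theorem eq_span_range_basis {M : Type*} [AddCommGroup M] [Module F M] (T : Submodule F M)
    {ι : Type*} (b : Basis ι F T) : T = span F (Set.range fun i => (b i : M)) := by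
  have h := congrArg (Submodule.map T.subtype) b.span_eq
  rw [Submodule.map_span, Submodule.map_subtype_top, ← Set.range_comp] at h
  exact h.symm

/-- `spanK (span_F S) = span_K (incl S)`. [folklore] -/
theorem spanK_span {n : ℕ} (S : Set (Fin n → F)) :
    spanK K (span F S) = span K (incl F K n '' S) := by
  refine le_antisymm ?_ (span_mono (Set.image_mono subset_span))
  rw [spanK, span_le, Set.image_subset_iff]
  intro x hx
  refine span_induction (fun y hy => subset_span ⟨y, hy, rfl⟩) (by simp) (fun y z _ _ hy hz => ?_)
    (fun a y _ hy => ?_) hx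
  · simpa using add_mem hy hz
  · rw [Set.mem_preimage, LinearMap.map_smul, algebra_compatible_smul K a]
    exact smul_mem _ _ hy

/-- **`dim_K spanK T = dim_F T`**: the dimension of a rational subspace is the dimension of its
space of `F`-points. [folklore] -/
theorem finrank_spanK {n : ℕ} (T : Submodule F (Fin n → F)) :
    finrank K (spanK K T) = finrank F T := by
  set τ := finrank F T
  let b : Basis (Fin τ) F T := finBasis F T
  have hb : LinearIndependent F (fun i => (b i : Fin n → F)) :=
    b.linearIndependent.map' T.subtype T.ker_subtype
  have hT : T = span F (Set.range fun i => (b i : Fin n → F)) :=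
    eq_span_range_basis T b
  have hK : spanK K T = span K (Set.range (incl F K n ∘ fun i => (b i : Fin n → F))) := by
    rw [Set.range_comp, ← spanK_span, ← hT]
  rw [hK, finrank_span_eq_card (linearIndependent_incl_comp hb), Fintype.card_fin]

/-- **A rational subspace has no new `F`-points**: if `incl x ∈ spanK T` then `x ∈ T`.
[folklore] -/
theorem mem_of_incl_mem_spanK {n : ℕ} {T : Submodule F (Fin n → F)} {x : Fin n → F}
    (hx : incl F K n x ∈ spanK K T) : x ∈ T := by
  by_contra hxT
  set τ := finrank F T
  let b : Basis (Fin τ) F T := finBasis F T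
  have hb : LinearIndependent F (fun i => (b i : Fin n → F)) :=
    b.linearIndependent.map' T.subtype T.ker_subtype
  have hT : T = span F (Set.range fun i => (b i : Fin n → F)) :=
    eq_span_range_basis T b
  have hcons : LinearIndependent F (Fin.cons x (fun i => (b i : Fin n → F))) := by
    rw [linearIndependent_finCons]
    exact ⟨hb, by rwa [← hT]⟩
  have hK := linearIndependent_incl_comp (K := K) hcons
  have hcomp : incl F K n ∘ Fin.cons x (fun i => (b i : Fin n → F)) =
      Fin.cons (incl F K n x) (incl F K n ∘ fun i => (b i : Fin n → F)) := by
    funext i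
    refine Fin.cases ?_ (fun j => ?_) i <;> simp
  rw [hcomp, linearIndependent_finCons] at hK
  apply hK.2
  have : spanK K T = span K (Set.range (incl F K n ∘ fun i => (b i : Fin n → F))) := by
    rw [Set.range_comp, ← spanK_span, ← hT]
  rwa [← this]

/-- The `F`-points of a `K`-subspace `T ⊆ K^n`: the `F`-subspace `{x ∈ F^n | incl x ∈ T}`.
[cite: Roy1992, Notations (p. 24)] -/
def fPoints {n : ℕ} (T : Submodule K (Fin n → K)) : Submodule F (Fin n → F) :=
  (T.restrictScalars F).comap (incl F K n)

/-- Membership in `fPoints`. [folklore] -/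
@[simp] theorem mem_fPoints {n : ℕ} {T : Submodule K (Fin n → K)} {x : Fin n → F} :
    x ∈ fPoints (F := F) T ↔ incl F K n x ∈ T := Iff.rfl

/-- `spanK (fPoints T) ≤ T` (the largest rational subspace inside `T`). [folklore] -/
theorem spanK_fPoints_le {n : ℕ} (T : Submodule K (Fin n → K)) : spanK K (fPoints (F := F) T) ≤ T := by
  rw [spanK, span_le]
  rintro _ ⟨x, hx, rfl⟩
  exact hx

/-- `fPoints (spanK T) = T`. [folklore] -/
theorem fPoints_spanK {n : ℕ} (T : Submodule F (Fin n → F)) : fPoints (spanK K T) = T := by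
  ext x
  rw [mem_fPoints]
  exact ⟨mem_of_incl_mem_spanK, fun hx => subset_span ⟨x, hx, rfl⟩⟩

/-! ### Ranks and kernels under base change -/

/-- **The rank of a matrix is invariant under base change** `F → K`. [folklore] -/
theorem rank_map_algebraMap {m n : ℕ} (A : Matrix (Fin m) (Fin n) F) :
    (A.map (algebraMap F K)).rank = A.rank := by
  rw [Matrix.rank_eq_finrank_span_cols, Matrix.rank_eq_finrank_span_cols,
    ← finrank_spanK (K := K) (span F (Set.range A.col)), spanK_span, ← Set.range_comp]
  rfl

/-- A matrix over `F` acting on `K^n` commutes with the inclusion: `A_K (incl x) = incl (A x)`. [folklore] -/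
theorem map_mulVec_incl {m n : ℕ} (A : Matrix (Fin m) (Fin n) F) (x : Fin n → F) :
    (A.map (algebraMap F K)).mulVecLin (incl F K n x) = incl F K m (A.mulVecLin x) := by
  funext i
  simp only [Matrix.mulVecLin_apply, incl_apply]
  rw [RingHom.map_mulVec]
  rfl

/-- **Kernels of rational maps are rational**: the kernel on `K^n` of a matrix with entries in `F`
is the `K`-span of its kernel on `F^n`. [folklore] -/
theorem ker_mulVecLin_map {m n : ℕ} (A : Matrix (Fin m) (Fin n) F) :
    LinearMap.ker (A.map (algebraMap F K)).mulVecLin = spanK K (LinearMap.ker A.mulVecLin) := by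
  symm
  apply Submodule.eq_of_le_of_finrank_eq
  · rw [spanK, span_le]
    rintro _ ⟨x, hx, rfl⟩
    rw [SetLike.mem_coe, LinearMap.mem_ker, map_mulVec_incl, LinearMap.mem_ker.1 hx, map_zero]
  · rw [finrank_spanK]
    have h1 := LinearMap.finrank_range_add_finrank_ker (A.map (algebraMap F K)).mulVecLin
    have h2 := LinearMap.finrank_range_add_finrank_ker A.mulVecLin
    have h3 : finrank K (LinearMap.range (A.map (algebraMap F K)).mulVecLin) =
        finrank F (LinearMap.range A.mulVecLin) := by
      rw [← Matrix.rank, ← Matrix.rank, rank_map_algebraMap]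
    rw [finrank_fin_fun] at h1 h2
    omega

/-! ### Rational quotient maps -/

/-- **Every rational subspace is the kernel of a rational surjection**: for an `F`-subspace
`T ⊆ F^n` there is a surjective `K`-linear `t₁ : K^n → K^{d₁}`, `d₁ = n − dim_F T`, given by a
matrix with entries in `F`, whose kernel is `spanK T` (complete a basis of `T` to a basis of `F^n`
and project on the last `d₁` coordinates). [cite: Roy1992, §4 proof of Theorem 4 (p. 35)] -/
theorem exists_surjective_ker_eq_spanK {n : ℕ} (T : Submodule F (Fin n → F)) :
    ∃ (d₁ : ℕ) (A : Matrix (Fin d₁) (Fin n) F), d₁ + finrank F T = n ∧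
      Function.Surjective (A.map (algebraMap F K)).mulVecLin ∧
      LinearMap.ker (A.map (algebraMap F K)).mulVecLin = spanK K T := by
  set τ := finrank F T with hτ
  have hτn : τ ≤ n := by simpa using T.finrank_le
  let b : Basis (Fin τ) F T := finBasis F T
  have hb : LinearIndependent F (fun i => (b i : Fin n → F)) :=
    b.linearIndependent.map' T.subtype T.ker_subtype
  have hT : T = span F (Set.range fun i => (b i : Fin n → F)) :=
    eq_span_range_basis T b
  obtain ⟨B, hB, hBrows⟩ := exists_isUnit_rows_eq _ hb
  -- `C = Bᵀ` has the basis of `T` as its first `τ` columns; `A` = last `n - τ` rows of `C⁻¹`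
  set C : Matrix (Fin n) (Fin n) F := B.transpose with hC
  have hCu : IsUnit C.det := by
    rw [hC, Matrix.det_transpose]
    exact (Matrix.isUnit_iff_isUnit_det B).1 hB
  have hsplit : τ + (n - τ) = n := by omega
  let e : Fin (n - τ) → Fin n := fun i => Fin.cast hsplit (Fin.natAdd τ i)
  let A : Matrix (Fin (n - τ)) (Fin n) F := C⁻¹.submatrix e id
  have hAC : A * C = (1 : Matrix (Fin n) (Fin n) F).submatrix e id := by
    rw [← Matrix.nonsing_inv_mul C hCu,
      Matrix.submatrix_mul _ _ e _root_.id _root_.id Function.bijective_id, Matrix.submatrix_id_id]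
  have he : ∀ i : Fin (n - τ), ((e i : Fin n) : ℕ) = τ + i := fun i => rfl
  -- surjective: `A (C z') = z` where `z'` is `z` padded by zeros
  have hsurj : Function.Surjective (A.map (algebraMap F K)).mulVecLin := by
    intro z
    let z' : Fin n → K := fun j => if h : τ ≤ (j : ℕ) then z ⟨j - τ, by omega⟩ else 0
    refine ⟨(C.map (algebraMap F K)).mulVecLin z', ?_⟩
    rw [Matrix.mulVecLin_apply, Matrix.mulVecLin_apply, Matrix.mulVec_mulVec, ← Matrix.map_mul,
      hAC]
    funext i
    rw [Matrix.mulVec, dotProduct, Finset.sum_eq_single (e i)]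
    · have hz : z' (e i) = z i := by
        simp only [z', he, Nat.le_add_right, ↓reduceDIte]
        congr 1
        ext
        simp
      rw [hz, Matrix.map_apply, Matrix.submatrix_apply,
        show (1 : Matrix (Fin n) (Fin n) F) (e i) (id (e i)) = 1 from Matrix.one_apply_eq (e i),
        map_one, one_mul]
    · intro j _ hj
      exact mul_eq_zero.2 (Or.inl (by
        rw [Matrix.map_apply, Matrix.submatrix_apply]
        exact (map_eq_zero _).2 (Matrix.one_apply_ne (Ne.symm hj))))
    · simp
  refine ⟨n - τ, A, by omega, hsurj, ?_⟩
  -- kernel: `spanK T ⊆ ker` since `A (b i) = (A C) eᵢ = 0` for `i < τ`, and the dimensions agree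
  symm
  apply Submodule.eq_of_le_of_finrank_eq
  · rw [spanK, span_le]
    rintro _ ⟨x, hx, rfl⟩
    rw [SetLike.mem_coe, LinearMap.mem_ker, map_mulVec_incl]
    suffices hx0 : A.mulVecLin x = 0 by rw [hx0, map_zero]
    -- `x = ∑ cᵢ bᵢ` and `A bᵢ = 0`
    have hcol : ∀ i : Fin τ, (b i : Fin n → F) = C.mulVec (Pi.single (Fin.castLE hτn i) 1) := by
      intro i
      rw [Matrix.mulVec_single_one]
      funext r
      change (b i : Fin n → F) r = C r (Fin.castLE hτn i)
      rw [hC, Matrix.transpose_apply, hBrows (Fin.castLE hτn i) (by simp)]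
      rfl
    have hAb : ∀ i : Fin τ, A.mulVec (b i : Fin n → F) = 0 := by
      intro i
      rw [hcol, Matrix.mulVec_mulVec, hAC, Matrix.mulVec_single_one]
      funext r
      rw [Pi.zero_apply, Matrix.col_apply, Matrix.submatrix_apply]
      refine Matrix.one_apply_ne ?_
      intro h
      have h1 := congrArg Fin.val h
      rw [he] at h1
      simp at h1
      omega
    have hxsum : x = ∑ i, (b.repr ⟨x, hx⟩ i) • (b i : Fin n → F) := by
      conv_lhs => rw [show x = ((⟨x, hx⟩ : T) : Fin n → F) from rfl, ← b.sum_repr ⟨x, hx⟩]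
      simp only [Submodule.coe_sum, Submodule.coe_smul]
    rw [Matrix.mulVecLin_apply, hxsum, Matrix.mulVec_sum]
    refine Finset.sum_eq_zero fun i _ => ?_
    rw [Matrix.mulVec_smul, hAb, smul_zero]
  · rw [finrank_spanK]
    have h1 := LinearMap.finrank_range_add_finrank_ker (A.map (algebraMap F K)).mulVecLin
    rw [LinearMap.range_eq_top.2 hsurj, finrank_top, finrank_fin_fun, finrank_fin_fun] at h1
    omega

/-! ### Dimension bookkeeping -/

section Bookkeeping

variable {E E' : Type*} [AddCommGroup E] [Module K E] [AddCommGroup E'] [Module K E']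

/-- `comap φ U + A = comap φ (U + φ(A))`. [folklore] -/
theorem comap_sup_eq_comap (φ : E →ₗ[K] E') (U : Submodule K E') (A : Submodule K E) :
    U.comap φ ⊔ A = (U ⊔ A.map φ).comap φ := by
  refine le_antisymm (sup_le (comap_mono le_sup_left)
    ((le_comap_map φ A).trans (comap_mono le_sup_right))) ?_
  intro x hx
  rw [mem_comap, mem_sup] at hx
  obtain ⟨u, hu, w, hw, huw⟩ := hx
  obtain ⟨a, ha, rfl⟩ := mem_map.1 hw
  rw [mem_sup]
  refine ⟨x - a, ?_, a, ha, by abel⟩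
  rw [mem_comap, map_sub, ← huw, add_sub_cancel_right]
  exact hu

variable [FiniteDimensional K E]

/-- `dim s(V) + dim ker s = dim (V + ker s)`. [folklore] -/
theorem finrank_map_add_finrank_ker (s : E →ₗ[K] E') (V : Submodule K E) :
    finrank K (V.map s) + finrank K (LinearMap.ker s) = finrank K ↥(V ⊔ LinearMap.ker s) := by
  set W := V ⊔ LinearMap.ker s
  have hW : V.map s = W.map s := by
    rw [Submodule.map_sup, (LinearMap.le_ker_iff_map).1 le_rfl, sup_bot_eq]
  have h := LinearMap.finrank_range_add_finrank_ker (s.domRestrict W)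
  rw [LinearMap.range_domRestrict, LinearMap.ker_domRestrict, ← hW,
    (Submodule.comapSubtypeEquivOfLe (le_sup_right : LinearMap.ker s ≤ W)).finrank_eq] at h
  exact h

/-- For a surjection, `dim φ⁻¹(U) = dim U + dim ker φ`. [folklore] -/
theorem finrank_comap_of_surjective (φ : E →ₗ[K] E') (hφ : Function.Surjective φ)
    (U : Submodule K E') : finrank K (U.comap φ) = finrank K U + finrank K (LinearMap.ker φ) := by
  have h := LinearMap.finrank_range_add_finrank_ker (φ.domRestrict (U.comap φ))
  rw [LinearMap.range_domRestrict, Submodule.map_comap_eq_of_surjective hφ,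
    LinearMap.ker_domRestrict,
    (Submodule.comapSubtypeEquivOfLe (by exact comap_mono bot_le : LinearMap.ker φ ≤ U.comap φ)).finrank_eq]
    at h
  exact h.symm

omit [FiniteDimensional K E] in
/-- `dim (p × q) = dim p + dim q` for submodules. [folklore] -/
theorem finrank_prod_eq (p : Submodule K E) (q : Submodule K E') [FiniteDimensional K p]
    [FiniteDimensional K q] : finrank K (p.prod q) = finrank K p + finrank K q := by
  let f : (p.prod q) →ₗ[K] p × q :=
    { toFun := fun x => (⟨x.1.1, x.2.1⟩, ⟨x.1.2, x.2.2⟩)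
      map_add' := fun _ _ => rfl
      map_smul' := fun _ _ => rfl }
  have hf : Function.Bijective f := by
    constructor
    · rintro ⟨⟨a, b⟩, h⟩ ⟨⟨a', b'⟩, h'⟩ hh
      simp only [f, LinearMap.coe_mk, AddHom.coe_mk, Prod.mk.injEq, Subtype.mk.injEq] at hh
      obtain ⟨rfl, rfl⟩ := hh
      rfl
    · rintro ⟨⟨a, ha⟩, ⟨b, hb⟩⟩
      exact ⟨⟨(a, b), ha, hb⟩, rfl⟩
  rw [(LinearEquiv.ofBijective f hf).finrank_eq, Module.finrank_prod]

end Bookkeeping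

end Literature.Barriers.Schanuel.Roy1992
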